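import Literature.NumberTheory.Automorphic.CDTModularityProofs
import HarnessLib

/-!
# Crux `FreyModularity` (stmt-ABC-11340), line `Sketch`, stub `stub_absIrrSqrtFive`:
# the Galois half — `Γ_{ℚ(√5)}` acts on `μ₅` through squares, and a rational eigenvector

First support file for the stub `stub_absIrrSqrtFive` of the line `Sketch` (Rubin, *Modularity of
mod 5 representations*, in Cornell–Silverman–Stevens 1997, Prop. 7: for `E/ℚ` semistable at `5`
with `ρ̄_{E,5}` irreducible, `ρ̄_{E,5}|_{ℚ(√5)}` is absolutely irreducible).  In the architecture
of the tree's `BCDT.isAbsIrreducibleOverSqrt_five_of_orderOf_eq_three` (`CDTModularityProofs`):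

* `sq_modPCyclotomicCharacter_eq_one_of_mem_range` — for `σ` in the image of `Γ_L → Γ_ℚ` (`L` a
  splitting field of `X² - 5`), `χ̄₅(σ)² = 1` (Gauss: `(ζ + ζ⁴ - ζ² - ζ³)² = 5`, and
  `ζ ↦ ζ²`, `ζ ↦ ζ³` negate this sum);
* `exists_common_eigenvector_of_not_isAbsolutelyIrreducible` — if `ρ̄|_{Γ_L}` (`det ρ̄ = χ̄₅`) is
  not absolutely irreducible, `ρ̄(Γ_L)` has a common `𝔽₅`-rational eigenvector (complex
  conjugation lies in `Γ_L` and has the rational eigenvalues `±1`; verbatim the first half of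
  the tree's proof of `isAbsIrreducibleOverSqrt_five_of_orderOf_eq_three`).

The criterion built on them (`isAbsIrreducibleOverSqrt_five_of_mulVec_eq_self`) and the
arithmetic half are in the sibling files `…StubAbsIrrSqrtFiveGroup`, `…StubAbsIrrSqrtFiveLocal`,
`…StubAbsIrrSqrtFive`.

## References

* [RubinCSS1997] K. Rubin, *Modularity of mod 5 representations*, in: G. Cornell,
  J. H. Silverman, G. Stevens (eds.), *Modular Forms and Fermat's Last Theorem*, Springer (1997),
  Prop. 7 and its proof.
* [ConradDiamondTaylor1999] B. Conrad, F. Diamond, R. Taylor, J. Amer. Math. Soc. 12 (1999),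
  proof of Lemma 7.2.3 (p. 554).
-/

-- `Summit.<Summit>.<Problem>` is the mandated summit-side namespace (CONVENTIONS §2); for the
-- single-conjunct summit `ABC` the two coincide, so the duplicate `ABC.ABC` is deliberate.
set_option linter.dupNamespace false

noncomputable section

open scoped MatrixGroups Polynomial

open Polynomial Matrix Field
open Literature.NumberTheory.EllipticCurves
open Literature.NumberTheory.Automorphic
open Literature.NumberTheory.Automorphic.BCDT
open Literature.NumberTheory.GaloisRepresentations
open WeierstrassCurve

namespace Summit.ABC.ABC.Theorems

/-! ## `Γ_{ℚ(√5)}` acts on `μ₅` through squares -/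

/-- **`χ̄₅(σ)² = 1` for `σ ∈ Γ_{ℚ(√5)}`.**  For a splitting field `L` of `X² - 5` over `ℚ` and
`σ` in the image of `Γ_L → Γ_ℚ`, the mod-`5` cyclotomic character of `σ` is a square root of `1`:
with `ζ ∈ ℚ̄` a primitive fifth root of unity, the Gauss sum `s = ζ + ζ⁴ - ζ² - ζ³` has `s² = 5`,
so `s` is (the image of) an element of `L` and `σ s = s`; but `σ ζ = ζ^a` with `a = χ̄₅(σ)`, and
for `a ∈ {2, 3}` one gets `σ s = -s ≠ s`. [folklore] -/
theorem sq_modPCyclotomicCharacter_eq_one_of_mem_range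
    (L : Type*) [Field L] [Algebra ℚ L] [IsSplittingField ℚ L (X ^ 2 - C (5 : ℚ))]
    {σ : absoluteGaloisGroup ℚ} (hσ : σ ∈ Set.range (absGaloisRestrict ℚ L)) :
    modPCyclotomicCharacterZMod ℚ 5 σ ^ 2 = 1 := by
  haveI : FiniteDimensional ℚ L := IsSplittingField.finiteDimensional L (X ^ 2 - C (5 : ℚ))
  -- a primitive fifth root of unity `ζ ∈ ℚ̄` and the Gauss sum `s`, `s² = 5`
  obtain ⟨ζ, hζ⟩ := HasEnoughRootsOfUnity.exists_primitiveRoot (AlgebraicClosure ℚ) 5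
  have h5 : ζ ^ 5 = 1 := hζ.pow_eq_one
  have hsum : 1 + ζ + ζ ^ 2 + ζ ^ 3 + ζ ^ 4 = 0 := by
    have := hζ.geom_sum_eq_zero (by norm_num : 1 < 5)
    simpa [Finset.sum_range_succ] using this
  set s : AlgebraicClosure ℚ := ζ + ζ ^ 4 - ζ ^ 2 - ζ ^ 3 with hs
  have hs2 : s ^ 2 = 5 := by
    rw [hs]; linear_combination (ζ ^ 3 - 2 * ζ ^ 2 - ζ + 4) * h5 - hsum
  have hs0 : s ≠ 0 := by
    intro h0; rw [h0] at hs2; norm_num at hs2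
  -- `σ` fixes `s`: `s` is the image of a square root of `5` in `L`
  have hfix : σ • s = s := by
    obtain ⟨α, hα⟩ : ∃ α : L, α ^ 2 = 5 := by
      set p : ℚ[X] := X ^ 2 - C (5 : ℚ) with hp
      have hp0 : p ≠ 0 := irreducible_X_pow_two_sub_C_five.ne_zero
      have hdeg : p.natDegree = 2 := by rw [hp]; exact natDegree_X_pow_sub_C
      have hd : (p.map (algebraMap ℚ L)).degree ≠ 0 := by
        rw [degree_map, degree_eq_natDegree hp0, hdeg]; decide
      obtain ⟨α, hα⟩ := (IsSplittingField.splits L p).exists_eval_eq_zero hd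
      refine ⟨α, ?_⟩
      have h1 : aeval α p = 0 := by rwa [aeval_def, eval₂_eq_eval_map]
      rw [hp, map_sub, map_pow, aeval_X, aeval_C, sub_eq_zero] at h1
      simpa using h1
    set e := absClosureEquiv ℚ L with he
    have key := (mem_range_absGaloisRestrict_iff σ).mp hσ
    have hes : (e s) ^ 2 = (algebraMap L (AlgebraicClosure L) α) ^ 2 := by
      rw [← map_pow, hs2, ← map_pow, hα, map_ofNat, map_ofNat]
    obtain ⟨x, hx⟩ : ∃ x : L, algebraMap L (AlgebraicClosure L) x = e s := by
      rcases sq_eq_sq_iff_eq_or_eq_neg.mp hes with h | h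
      · exact ⟨α, h.symm⟩
      · exact ⟨-α, by rw [map_neg, h]⟩
    have h1 := key x
    rw [hx, absGaloisTransport_apply, ← he, AlgEquiv.symm_apply_apply] at h1
    exact e.injective h1
  -- `σ ζ = ζ ^ a`, `a = χ̄₅(σ)`
  set u := modPCyclotomicCharacterZMod ℚ 5 σ with hu
  have hζσ : σ • ζ = ζ ^ (u : ZMod 5).val := modPCyclotomicCharacterZMod_spec ℚ 5 σ ζ h5
  have hsσ : σ • s = ζ ^ (u : ZMod 5).val + (ζ ^ (u : ZMod 5).val) ^ 4 -
      (ζ ^ (u : ZMod 5).val) ^ 2 - (ζ ^ (u : ZMod 5).val) ^ 3 := by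
    rw [hs, smul_sub, smul_sub, smul_add, smul_pow', smul_pow', smul_pow', hζσ]
  by_contra hne
  have hval : (u : ZMod 5).val = 2 ∨ (u : ZMod 5).val = 3 := by
    have key : ∀ w : (ZMod 5)ˣ, w ^ 2 ≠ 1 → (w : ZMod 5).val = 2 ∨ (w : ZMod 5).val = 3 := by
      decide
    exact key u hne
  have hneg : σ • s = -s := by
    rcases hval with h | h <;> rw [hsσ, h, hs]
    · linear_combination (ζ ^ 3 - ζ) * h5
    · linear_combination (ζ ^ 7 + ζ ^ 2 - ζ ^ 4 - ζ) * h5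
  rw [hfix] at hneg
  have h2 : (2 : AlgebraicClosure ℚ) * s = 0 := by linear_combination hneg
  rcases mul_eq_zero.mp h2 with h | h
  · norm_num at h
  · exact hs0 h


/-! ## A common rational eigenvector of `ρ̄(Γ_{ℚ(√5)})` -/

/-- **If `ρ̄|_{Γ_{ℚ(√5)}}` is not absolutely irreducible, `ρ̄(Γ_{ℚ(√5)})` has a common
`𝔽₅`-rational eigenvector** (for `ρ̄ : Γ_ℚ → GL₂(𝔽₅)` continuous with `det ρ̄ = χ̄₅`, and `L` a
splitting field of `X² - 5`).  A `Γ_L`-stable line over an extension `B ⊇ 𝔽₅` is an eigenline of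
the image `C` of complex conjugation (`c ∈ Γ_L` as `ℚ(√5)` is real; `C² = 1`,
`det C = χ̄₅(c) = -1`), hence is spanned by an `𝔽₅`-rational vector `w₀`, which is then a common
eigenvector of `ρ̄(Γ_L)` with rational eigenvalues.  Verbatim the first half of the tree's proof
of `BCDT.isAbsIrreducibleOverSqrt_five_of_orderOf_eq_three` (Conrad–Diamond–Taylor 1999, proof
of Lemma 7.2.3, p. 554, "using complex conjugation"). [folklore] -/
theorem exists_common_eigenvector_of_not_isAbsolutelyIrreducible
    (L : Type) [Field L] [Algebra ℚ L] [IsSplittingField ℚ L (X ^ 2 - C (5 : ℚ))]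
    (ρ : ModPGaloisRep ℚ (ZMod 5) 2)
    (hdet : ∀ σ : absoluteGaloisGroup ℚ,
      Matrix.GeneralLinearGroup.det (ρ σ) = modPCyclotomicCharacterZMod ℚ 5 σ)
    (h : ¬ FramedRep.IsAbsolutelyIrreducible (FramedGaloisRep.restrictField L ρ)) :
    ∃ w₀ : Fin 2 → ZMod 5, w₀ ≠ 0 ∧ ∀ g : absoluteGaloisGroup L, ∃ ν : ZMod 5,
      ((ρ (absGaloisRestrict ℚ L g) : GL (Fin 2) (ZMod 5)) : Matrix (Fin 2) (Fin 2) (ZMod 5)) *ᵥ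
        w₀ = ν • w₀ := by
  classical
  by_contra hw
  apply h
  intro B _ f
  set r := absGaloisRestrict ℚ L with hr
  -- the matrices `A g = ρ̄(g) ∈ M₂(𝔽₅)`
  set A : absoluteGaloisGroup ℚ → Matrix (Fin 2) (Fin 2) (ZMod 5) :=
    fun g ↦ ((ρ g : GL (Fin 2) (ZMod 5)) : Matrix (Fin 2) (Fin 2) (ZMod 5)) with hA
  have hAmul : ∀ g h, A (g * h) = A g * A h := fun g h ↦ by
    simp only [hA, map_mul, Units.val_mul]
  have hAone : A 1 = 1 := by simp only [hA, map_one, Units.val_one]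
  set ρ' := (FramedGaloisRep.restrictField L ρ).baseChangeRepresentation f with hρ'def
  have hρ' : ∀ (g : absoluteGaloisGroup L) (v : Fin 2 → B), ρ' g v = (A (r g)).map f *ᵥ v := by
    intro g v
    rw [hρ'def, FramedRep.baseChangeRepresentation_apply_apply, FramedGaloisRep.restrictField_apply]
    rfl
  -- non-triviality of the lattice of subrepresentations
  haveI : Nontrivial (Subrepresentation ρ') := by
    refine ⟨⟨⊥, ⊤, fun h ↦ ?_⟩⟩
    have h' := congrArg Subrepresentation.toSubmodule h
    exact bot_ne_top (α := Submodule B (Fin 2 → B)) h'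
  refine ⟨fun S ↦ ?_⟩
  rcases eq_or_ne S ⊥ with h | hSbot
  · exact Or.inl h
  rcases eq_or_ne S ⊤ with h | hStop
  · exact Or.inr h
  exfalso
  -- `U = S` is a line `B ∙ v`
  set U : Submodule B (Fin 2 → B) := S.toSubmodule with hU
  have hUbot : U ≠ ⊥ := fun h ↦ hSbot (Subrepresentation.toSubmodule_injective h)
  have hUtop : U ≠ ⊤ := fun h ↦ hStop (Subrepresentation.toSubmodule_injective h)
  have hfin2 : Module.finrank B (Fin 2 → B) = 2 := by simp
  have hU1 : Module.finrank B U = 1 := by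
    have hlt : Module.finrank B U < Module.finrank B (Fin 2 → B) :=
      Submodule.finrank_lt hUtop
    have hpos : Module.finrank B U ≠ 0 := fun h ↦ hUbot (Submodule.finrank_eq_zero.mp h)
    omega
  obtain ⟨v, hvU, hv⟩ := Submodule.exists_mem_ne_zero_of_ne_bot hUbot
  have hUspan : U = B ∙ v := by
    refine (Submodule.eq_of_le_of_finrank_eq ((Submodule.span_singleton_le_iff_mem v U).mpr hvU)
      ?_).symm
    rw [finrank_span_singleton hv, hU1]
  -- `v` is a common eigenvector of `ρ̄(Γ_L)`
  have heig : ∀ g : absoluteGaloisGroup L, ∃ μ : B, (A (r g)).map f *ᵥ v = μ • v := by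
    intro g
    have hmem : ρ' g v ∈ U := S.apply_mem_toSubmodule g hvU
    rw [hρ', hUspan, Submodule.mem_span_singleton] at hmem
    obtain ⟨μ, hμ⟩ := hmem
    exact ⟨μ, hμ.symm⟩
  -- complex conjugation `c₀ = r c`, `C = ρ̄(c₀)`: `C² = 1`, `det C = -1`
  obtain ⟨c₀, hc₀⟩ := exists_isComplexConjugation (Rat.castHom ℝ)
  obtain ⟨c, hc⟩ := mem_range_absGaloisRestrict_of_isComplexConjugation L hc₀
  set C := A c₀ with hC
  have hC2 : C * C = 1 := by
    rw [hC, ← hAmul, ← pow_two, hc₀.sq_eq_one, hAone]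
  have hdetC : C.det = -1 := by
    have h1 := congrArg (fun u : (ZMod 5)ˣ ↦ (u : ZMod 5)) (hdet c₀)
    simp only [Matrix.GeneralLinearGroup.val_det_apply] at h1
    rw [hC, hA, h1, modPCyclotomicCharacterZMod_eq_modNCyclotomicCharacter]
    exact modNCyclotomicCharacter_of_isComplexConjugation (N := 5) hc₀
  obtain ⟨μc, hμc⟩ := heig c
  rw [hc] at hμc
  -- `μc = ±1`
  have hμc2 : μc * μc = 1 := by
    have h1 : (C.map f) *ᵥ ((C.map f) *ᵥ v) = (μc * μc) • v := by
      rw [hμc, mulVec_smul, hμc, smul_smul]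
    rw [mulVec_mulVec, ← Matrix.map_mul, hC2, Matrix.map_one f (map_zero f) (map_one f),
      one_mulVec] at h1
    have h2 : (μc * μc - 1) • v = 0 := by rw [sub_smul, one_smul, ← h1, sub_self]
    rcases smul_eq_zero.mp h2 with h | h
    · exact (sub_eq_zero.mp h)
    · exact absurd h hv
  obtain ⟨μ₀, hμ₀⟩ : ∃ μ₀ : ZMod 5, f μ₀ = μc ∧ μ₀ ^ 2 = 1 := by
    rcases mul_self_eq_one_iff.mp hμc2 with h | h
    · exact ⟨1, by rw [map_one, h], one_pow 2⟩
    · exact ⟨-1, by rw [map_neg, map_one, h], by ring⟩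
  -- `N = C - μ₀` is a non-zero singular matrix over `𝔽₅`
  set N : Matrix (Fin 2) (Fin 2) (ZMod 5) := C - μ₀ • (1 : Matrix (Fin 2) (Fin 2) (ZMod 5))
    with hN
  have hNf : N.map f = C.map f - μc • (1 : Matrix (Fin 2) (Fin 2) B) := by
    ext i j
    by_cases hij : i = j
    · subst hij; simp [hN, Matrix.map_apply, hμ₀.1]
    · simp [hN, Matrix.map_apply, hij]
  have hNv : N.map f *ᵥ v = 0 := by
    rw [hNf, sub_mulVec, smul_mulVec, one_mulVec, hμc, sub_self]
  have hdetN : N.det = 0 := by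
    have h1 : (N.map f).det = 0 := Matrix.exists_mulVec_eq_zero_iff.mp ⟨v, hv, hNv⟩
    have h2 : f N.det = 0 := by rw [RingHom.map_det, RingHom.mapMatrix_apply, h1]
    exact (map_eq_zero f).mp h2
  have hN0 : N ≠ 0 := by
    intro h0
    have hCeq : C = μ₀ • (1 : Matrix (Fin 2) (Fin 2) (ZMod 5)) := sub_eq_zero.mp (hN ▸ h0)
    have : C.det = 1 := by
      rw [hCeq, Matrix.det_smul, Matrix.det_one, mul_one, Fintype.card_fin, hμ₀.2]
    rw [hdetC] at this
    exact absurd this (by decide)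
  -- an `𝔽₅`-rational kernel vector `w₀` of `N`; over `B` the kernel is the line through it
  obtain ⟨w₀, hw₀, hNw₀⟩ := Matrix.exists_mulVec_eq_zero_iff.mpr hdetN
  set w : Fin 2 → B := f ∘ w₀ with hw'
  have hw0 : w ≠ 0 := by
    obtain ⟨i, hi⟩ : ∃ i, w₀ i ≠ 0 := Function.ne_iff.mp hw₀
    intro h0
    exact hi ((map_eq_zero f).mp (by simpa [hw'] using congrFun h0 i))
  have hmapvec : ∀ M : Matrix (Fin 2) (Fin 2) (ZMod 5), M.map f *ᵥ w = f ∘ (M *ᵥ w₀) := by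
    intro M
    funext i
    rw [hw', Function.comp_apply, RingHom.map_mulVec]
  have hNw : N.map f *ᵥ w = 0 := by
    rw [hmapvec, hNw₀]; funext i; simp
  set φN := (N.map f).mulVecLin with hφN
  have hker1 : Module.finrank B (LinearMap.ker φN) = 1 := by
    have hsum := LinearMap.finrank_range_add_finrank_ker φN
    rw [hfin2] at hsum
    have hrange : Module.finrank B (LinearMap.range φN) ≠ 0 := by
      intro h0
      rw [Submodule.finrank_eq_zero, LinearMap.range_eq_bot] at h0
      apply hN0
      ext i j
      have hij : (N.map f *ᵥ Pi.single j 1) i = 0 := by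
        have := congrArg (fun g ↦ g (Pi.single j 1) i) h0
        simpa [hφN] using this
      rw [mulVec_single_one] at hij
      simpa [Matrix.map_apply] using hij
    have hkerpos : Module.finrank B (LinearMap.ker φN) ≠ 0 := by
      intro h0
      rw [Submodule.finrank_eq_zero] at h0
      have : w ∈ LinearMap.ker φN := by rw [LinearMap.mem_ker, hφN, mulVecLin_apply, hNw]
      rw [h0, Submodule.mem_bot] at this
      exact hw0 this
    omega
  have hker : LinearMap.ker φN = B ∙ w := by
    have hwmem : w ∈ LinearMap.ker φN := by rw [LinearMap.mem_ker, hφN, mulVecLin_apply, hNw]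
    refine (Submodule.eq_of_le_of_finrank_eq
      ((Submodule.span_singleton_le_iff_mem w _).mpr hwmem) ?_).symm
    rw [finrank_span_singleton hw0, hker1]
  obtain ⟨lam, hlam⟩ : ∃ lam : B, lam • w = v := by
    have hvker : v ∈ LinearMap.ker φN := by rw [LinearMap.mem_ker, hφN, mulVecLin_apply, hNv]
    rw [hker, Submodule.mem_span_singleton] at hvker
    exact hvker
  have hlam0 : lam ≠ 0 := by
    rintro rfl
    rw [zero_smul] at hlam
    exact hv hlam.symm
  -- hence `w₀` is a common `𝔽₅`-rational eigenvector of `ρ̄(Γ_L)`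
  have heig₀ : ∀ g : absoluteGaloisGroup L, ∃ ν : ZMod 5, A (r g) *ᵥ w₀ = ν • w₀ := by
    intro g
    obtain ⟨μ, hμ⟩ := heig g
    have hμw : (A (r g)).map f *ᵥ w = μ • w := by
      apply smul_right_injective (Fin 2 → B) hlam0
      change lam • ((A (r g)).map f *ᵥ w) = lam • (μ • w)
      rw [← mulVec_smul, hlam, hμ, smul_comm, hlam]
    rw [hmapvec] at hμw
    exact exists_eq_smul_of_comp_eq_smul_comp f hw₀ hμw
  exact hw ⟨w₀, hw₀, heig₀⟩

/-- **Registered helper stub (Galois half) toward `stub_absIrrSqrtFive`**: the arrow form of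
`exists_common_eigenvector_of_not_isAbsolutelyIrreducible` — if `ρ̄|_{Γ_{ℚ(√5)}}` (`det ρ̄ = χ̄₅`)
is not absolutely irreducible, `ρ̄(Γ_{ℚ(√5)})` has a common `𝔽₅`-rational eigenvector.
[cite: ConradDiamondTaylor1999, proof of Lemma 7.2.3 (p. 554)] -/
theorem stub_absIrrSqrtFive_galois :
    ∀ (L : Type) [Field L] [Algebra ℚ L] [IsSplittingField ℚ L (X ^ 2 - C (5 : ℚ))]
      (ρ : ModPGaloisRep ℚ (ZMod 5) 2),
      (∀ σ : absoluteGaloisGroup ℚ,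
        Matrix.GeneralLinearGroup.det (ρ σ) = modPCyclotomicCharacterZMod ℚ 5 σ) →
      ¬ FramedRep.IsAbsolutelyIrreducible (FramedGaloisRep.restrictField L ρ) →
      ∃ w₀ : Fin 2 → ZMod 5, w₀ ≠ 0 ∧ ∀ g : absoluteGaloisGroup L, ∃ ν : ZMod 5,
        ((ρ (absGaloisRestrict ℚ L g) : GL (Fin 2) (ZMod 5)) : Matrix (Fin 2) (Fin 2) (ZMod 5)) *ᵥ
          w₀ = ν • w₀ := by
  intro L _ _ _ ρ hdet h
  exact exists_common_eigenvector_of_not_isAbsolutelyIrreducible L ρ hdet h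

end Summit.ABC.ABC.Theorems

end
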